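import Summits.QuantumFields.YangMills.Theorems.UnitScaleTiltProp8ChartHInvColumnGeometry
import HarnessLib

/-!
# Route `UnitScaleTilt`, crux K1 «MinimiserStabilityRegPr» (stmt-QuantumFields-19200), leaf V2′ `stub_halvingStep` — the P2→P3 BRIDGE in COLUMN form,
# part 2: **THE COLUMN LETTER (X2-H) OF THE CHART-H OF RECORD `H X = H₀ᴹX̃′ + dφ` AND THE PACKAGED BRIDGE `exists_rightInverse_col`** (supplier row
# (X2-H) of the dressing letter `C_E`, ★★OWNER g26 WANTED №g26-1 ∕ ACK 12 (b); weight of record `u(j,c) = η⁻³(Lʲη)⁻¹`, `v(b) = (L^{j(b)}η)⁻³`)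

Cell `ym3-torus` (HUMAN RULING D-0037, YM ladder rung R3 — YM₃ on the torus is a RUNG, not the Clay problem), width seat `ym-ust-19200-w8` gen 0.
`--supports stmt-QuantumFields-19200 --as helper`; def-free, 0 sorry, standard axioms.  Part 1 = `…ChartHInvColumnGeometry` (corrected data in `ℓ¹`).

THE STATEMENT (`ℓ¹`-dual of «`Hᵀ` maps `(Lʲη)³`-currents to `η³(Lʲη)`-index functions»; = the displayed binder `hHcol : ∀ X, Σ_b (w b)⁻¹·‖H X b‖ ≤ h₁·Σ_c u c·‖X c‖`
of `ym-ust-19936-w8`'s `…Prop8DressingTransposeLetters` at `w := w 3`, `u(j,c) := η⁻³(Lʲη)⁻¹`): `Σ_b (L^{j(b)}η)⁻³‖HX(b)‖ ≤ h₁·Σ_{(j,c)} η⁻³(Lʲη)⁻¹‖X(j,c)‖` for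
EVERY datum `X`, `h₁ = K₀(1 + θ(d+2)L(1+L³))(1 + 2d(d+2)L)`, `θ/Lʲ` the tents' slope (`2` for `exists_tent`, `8` for the smooth tents of (X3′)).  DISPLAYED INPUT: a
kernel majorant `k(b₋, i) ≥ |H₀(b, i)|` CONSTANT ON THE BLOCK OF EVERY SITE INDEX with the column sum `Σ_b (L^{j(b)}η)⁻³·k(b₋, i) ≤ K₀η⁻³` — for the canonical `flatH`:
[Balaban1984PropagatorsII] Cor. 2.8 (2.151)₁ over the port's block distance (P2's `HKernelRows` (k1)) + the transposed plain scale sum (2.61) with the level-free volume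
`3L^{3j}(Lʲη)⁻³ = 3η⁻³` per block (the concrete half, `ym-ust-19936-w3`'s bset-native `colSum_domT` — NOT here).  MECHANISM (print (88)–(90) pp. 291–292, transposed):
`Σ_b v(b)‖Y(b)‖ ≤ K₀η⁻³·Σ‖X̃′‖ ≤ K₀η⁻³(1 + 2d(d+2)L)Σ(Lʲη)⁻¹‖X‖` (part 1); for `dφ = d(Σ_s τ_s·Λ_s(Y))` only the tents of the blocks of the two end-points move across
`b` (slope `θ/L^{j(s)}`), `‖Λ_s(Y)‖ ≤ (d+2)L·L^{j(s)}·Σ_i k(centre(s), i)‖X̃′(i)‖` (`norm_combFamily_le` + block constancy; the `L^{j(s)}` CANCEL), the sums over the site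
indices collapse to the pins of the end-points (`sum_siteIdx_ite_block`), and the final points cost the collar factor `L³` (`colsum_tgt_le`: `j(b₊) ≤ j(b₋) + 1` and the
shift bijection `b ↦ ⟨b₊, dir b⟩`).

WHAT IS PROVED (sorry-free; no definition; every `P : Params`, nested `D`, `η > 0`, matrix size `n`; section-variables form of `ChartHInvBridge`∕`…Letter`, so it
holds for THE construction and ANY tent family with the support letter `hτ0` and a slope `θ/Lʲ`): `siteIdx_eq_pin_of_block`, `sum_siteIdx_ite_block` ((2.4));
§3 **`colsum_kernel_le`**, **`colsum_tgt_le`**, **`column_letter_Y`**, **`column_letter_dphi`**, ★**`column_letter`** (under `Adm22 D R M`, `R·M ≥ 1`); §4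
★★**`exists_rightInverse_col`** = `ChartHInvLetter.exists_rightInverse` WITH the column letter as a third conjunct for the SAME `H` (θ = 2).
HONEST SCOPE.  (i) The majorant `k`, its block constancy and its column sum are HYPOTHESES (P2-class; the concrete half discharges them at the `Adm22` families);
(ii) nothing of (72)∕(73) (`D′`, (X2-C′)), of `(∂*∂H)ᵀ` ((X2-CH)), of `C_E` or of the (165)-A₁ row is claimed; (iii) NOT a claim about the stub, the crux, the rung
or the mass gap.

References: T. Bałaban, CMP **102** (1985) 277–309 [Balaban1985Variational] (45)–(46) p.285, (88)–(90) pp.291–292, (156)–(157) p.302, (161)–(162) p.303; CMP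
**98** (1985) 17–51 [Balaban1985Averaging] (62) p.28; CMP **96** (1984) 223–250 [Balaban1984PropagatorsII] (2.1)–(2.4) p.224, (2.61) p.234, Cor. 2.8
(2.150)–(2.151) p.249.
-/

set_option autoImplicit false

noncomputable section

open scoped BigOperators Matrix.Norms.L2Operator

namespace Summit.QuantumFields.YangMills.Theorems.ChartHInv

open Literature.MathematicalPhysics.QuantumFieldTheory.Balaban1983to89
open T4Continuum BlockAveraging BlockAveragingEMLLinearised LatticeFieldCalculus
open B5Eq118OneStroke (iterBlockOf iterBlockOf_zero iterBlockOf_succ)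
open B15DeterminingSets (embIter)
open B6SectADomainsV1 (Domains)
open B6SectAOperatorsV1 (BondIdx SiteIdx)
open B11Eq115Space (levOf)
open Summit.QuantumFields.YangMills.Theorems.FlatCubeOpsText (Adm22)
open Literature.MathematicalPhysics.QuantumFieldTheory.BalabanImbrieJaffe1984to88.BIJ88RT51Background (iterBlockOf_embIter)

variable {P : Params} {n : Type*}

/-! ## §3 The column letter of `H X = Y X + dφ X` -/

section ConstructionB

variable (D : Domains P) (η : ℝ)
  (Λ : (i : ℕ) → (PBond P 0 → Matrix n n ℂ) → Site P i → Matrix n n ℂ)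
  (hΛ0 : ∀ Y y, Λ 0 Y y = 0)
  (hΛs : ∀ (i : ℕ) (Y : PBond P 0 → Matrix n n ℂ) (y : Site P (i + 1)), Λ (i + 1) Y y = (P.L ^ i : ℕ) • combMean (bondAvgIter i Y) y + Λ i Y (emb y))
  (Xf : (BondIdx D → Matrix n n ℂ) → (i : ℕ) → PBond P i → Matrix n n ℂ)
  (hXf : ∀ X i b, Xf X i b = if h : D.LamBond i b then X ⟨⟨⟨i, Nat.lt_succ_of_le (D.le_of_lamBond h)⟩, b⟩, h⟩ else 0)
  (κ : (BondIdx D → Matrix n n ℂ) → (j : ℕ) → Site P j → Matrix n n ℂ)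
  (hκ0 : ∀ X y, κ X 0 y = 0)
  (hκs : ∀ X (i : ℕ) (y : Site P (i + 1)), κ X (i + 1) y = if y ∈ D.Om (i + 1) then 0 else combMean (Xf X i) y)
  (Xt : (BondIdx D → Matrix n n ℂ) → BondIdx D → Matrix n n ℂ)
  (hXt : ∀ X idx, Xt X idx = (((P.L : ℝ) ^ (idx.1.1 : ℕ) * η)⁻¹) • (X idx + (κ X idx.1.1 idx.1.2.tgt - κ X idx.1.1 idx.1.2.src)))
  (H₀ : (BondIdx D → ℝ) →ₗ[ℝ] (PBond P 0 → ℝ))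
  (Y : (BondIdx D → Matrix n n ℂ) → PBond P 0 → Matrix n n ℂ)
  (hY : ∀ X b, Y X b = ∑ i : BondIdx D, H₀ (Pi.single i 1) b • Xt X i)
  (τ : SiteIdx D → Site P 0 → ℝ)
  (hτ0 : ∀ s x, iterBlockOf (s.1.1 : ℕ) x ≠ s.1.2 → τ s x = 0)
  (φ : (BondIdx D → Matrix n n ℂ) → Site P 0 → Matrix n n ℂ)
  (hφ : ∀ X x, φ X x = ∑ s : SiteIdx D, τ s x • Λ (s.1.1 : ℕ) (Y X) s.1.2)

/-- **A FINE SITE LIES IN THE BLOCK OF EXACTLY ONE SITE INDEX — ITS PIN** ((2.4): the territory and the block of the territory level).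
[cite: Balaban1984PropagatorsII, (2.4) p.224] -/
theorem siteIdx_eq_pin_of_block (x : Site P 0) (s : SiteIdx D) (h : iterBlockOf (s.1.1 : ℕ) x = s.1.2) :
    s = ⟨⟨⟨levOf (fun i => {z : Site P 0 | D.InOm i z}) D.k x, pin_mem D x⟩,
      iterBlockOf (levOf (fun i => {z : Site P 0 | D.InOm i z}) D.k x) x⟩, FlatCubeLevels.lamSite_levOf_inOm D x⟩ := by
  have hlev : levOf (fun i => {z : Site P 0 | D.InOm i z}) D.k x = (s.1.1 : ℕ) :=
    FlatCubeLevels.levOf_inOm_unique D (by rw [h]; exact s.2)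
  obtain ⟨⟨j, y⟩, hs⟩ := s
  simp only at h hlev ⊢
  have hjF : j = ⟨levOf (fun i => {z : Site P 0 | D.InOm i z}) D.k x, pin_mem D x⟩ := Fin.ext hlev.symm
  subst hjF; subst h; rfl

/-- **SUMS OVER THE SITE INDICES AGAINST THE BLOCK INDICATOR OF A FINE SITE COLLAPSE TO THE PIN.** [cite: Balaban1984PropagatorsII, (2.4) p.224] -/
theorem sum_siteIdx_ite_block (x : Site P 0) (f : SiteIdx D → ℝ) :
    ∑ s : SiteIdx D, (if iterBlockOf (s.1.1 : ℕ) x = s.1.2 then f s else 0) =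
      f ⟨⟨⟨levOf (fun i => {z : Site P 0 | D.InOm i z}) D.k x, pin_mem D x⟩,
        iterBlockOf (levOf (fun i => {z : Site P 0 | D.InOm i z}) D.k x) x⟩, FlatCubeLevels.lamSite_levOf_inOm D x⟩ := by
  classical
  rw [Finset.sum_eq_single ⟨⟨⟨levOf (fun i => {z : Site P 0 | D.InOm i z}) D.k x, pin_mem D x⟩,
        iterBlockOf (levOf (fun i => {z : Site P 0 | D.InOm i z}) D.k x) x⟩, FlatCubeLevels.lamSite_levOf_inOm D x⟩]
  · rw [if_pos rfl]
  · exact fun s _ hs => by rw [if_neg]; exact fun h => hs (siteIdx_eq_pin_of_block D x s h)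
  · intro h; exact absurd (Finset.mem_univ _) h

section ColumnLetter

variable [Fintype n] [DecidableEq n]
  (w₃ : PBond P 0 → ℝ) (hw₃ : ∀ b, w₃ b = ((P.L : ℝ) ^ levOf (fun i => {z : Site P 0 | D.InOm i z}) D.k b.src * η) ^ 3)
  {θ : ℝ} (hτlip : ∀ (s : SiteIdx D) (b : PBond P 0), |τ s b.tgt - τ s b.src| ≤ θ / (P.L : ℝ) ^ (s.1.1 : ℕ))
  -- the kernel majorant of `H₀`, constant on the block of every site index, with its transposed (column) sum
  (ks : Site P 0 → BondIdx D → ℝ) (hks0 : ∀ x i, 0 ≤ ks x i)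
  (hK : ∀ (i : BondIdx D) (b : PBond P 0), |H₀ (Pi.single i 1) b| ≤ ks b.src i)
  (hblk : ∀ (i : BondIdx D) (s : SiteIdx D) (x x' : Site P 0), iterBlockOf (s.1.1 : ℕ) x = s.1.2 → iterBlockOf (s.1.1 : ℕ) x' = s.1.2 →
    ks x i = ks x' i)
  {K₀ : ℝ} (hcol : ∀ i, ∑ b : PBond P 0, (w₃ b)⁻¹ * ks b.src i ≤ K₀ * (η⁻¹) ^ 3)

include hw₃ hK hcol in
/-- **THE COLUMN SUM OF THE KERNEL OF `H₀` AGAINST THE INVERSE WEIGHTS**: `Σ_b (L^{j(b)}η)⁻³·|H₀(b, i)| ≤ K₀η⁻³` for every index bond `i` — the displayed input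
(e.g. (2.151)₁ `|H₀(b,i)| ≤ C·e^{−δd(y(b₋), i)}` with the volume sum `3L^{3j}·(Lʲη)⁻³ = 3η⁻³` per block and the plain scale sum (2.61)).
[cite: Balaban1984PropagatorsII, (2.61) p.234, Cor. 2.8 (2.150)-(2.151) p.249] -/
theorem colsum_kernel_le (hη : 0 < η) (i : BondIdx D) : ∑ b : PBond P 0, (w₃ b)⁻¹ * |H₀ (Pi.single i 1) b| ≤ K₀ * (η⁻¹) ^ 3 := by
  have hL0 : (0 : ℝ) < P.L := by exact_mod_cast P.L_pos
  have hw0 : ∀ b, 0 ≤ (w₃ b)⁻¹ := fun b => by rw [hw₃]; positivity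
  exact le_trans (Finset.sum_le_sum fun b _ => mul_le_mul_of_nonneg_left (hK i b) (hw0 b)) (hcol i)

include hw₃ hks0 hcol in
/-- **THE COLUMN SUM AT THE FINAL POINTS**: `Σ_b (L^{j(b₋)}η)⁻³·k(b₊, i) ≤ L³·K₀η⁻³` — the territory collar `j(b₊) ≤ j(b₋) + 1` of (2.2) (`R·M ≥ 1`) and the shift
bijection `b ↦ ⟨b₊, dir b⟩` of the fine bonds. [cite: Balaban1984PropagatorsII, (2.2)-(2.4) p.224, (2.61) p.234] -/
theorem colsum_tgt_le (hη : 0 < η) {R M : ℕ} (hAdm : Adm22 D R M) (hRM : 1 ≤ R * M) (i : BondIdx D) :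
    ∑ b : PBond P 0, (w₃ b)⁻¹ * ks b.tgt i ≤ (P.L : ℝ) ^ 3 * (K₀ * (η⁻¹) ^ 3) := by
  classical
  have hL1 : (1 : ℝ) ≤ P.L := by exact_mod_cast P.L_pos
  have hL0 : (0 : ℝ) < P.L := by positivity
  -- the shift bijection of the fine bonds
  let e : PBond P 0 ≃ PBond P 0 :=
    { toFun := fun b => ⟨b.src.shift b.dir, b.dir⟩, invFun := fun b => ⟨b.src.unshift b.dir, b.dir⟩,
      left_inv := fun b => by show (⟨(b.src.shift b.dir).unshift b.dir, b.dir⟩ : PBond P 0) = b; rw [B10StarCount.unshift_shift],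
      right_inv := fun b => by show (⟨(b.src.unshift b.dir).shift b.dir, b.dir⟩ : PBond P 0) = b; rw [B10StarCount.shift_unshift] }
  have he : ∀ b : PBond P 0, (e b).src = b.tgt := fun b => rfl
  -- the collar: `(L^{j(b₋)}η)⁻³ ≤ L³·(L^{j(b₊)}η)⁻³`
  have hcollar : ∀ b : PBond P 0, (w₃ b)⁻¹ ≤ (P.L : ℝ) ^ 3 * (w₃ (e b))⁻¹ := by
    intro b
    rw [hw₃, hw₃, he]
    set j₁ := levOf (fun i => {z : Site P 0 | D.InOm i z}) D.k b.src with hj₁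
    set j₂ := levOf (fun i => {z : Site P 0 | D.InOm i z}) D.k b.tgt with hj₂
    have hcol := (levOf_endpoints_le_succ D hAdm hRM b).2
    rw [← hj₁, ← hj₂] at hcol
    have hpos₁ : 0 < ((P.L : ℝ) ^ j₁ * η) ^ 3 := by positivity
    rw [← div_eq_mul_inv ((P.L : ℝ) ^ 3), inv_le_comm₀ hpos₁ (by positivity), inv_div]
    rw [div_le_iff₀ (by positivity : (0 : ℝ) < (P.L : ℝ) ^ 3), ← mul_pow]
    have hpow : (P.L : ℝ) ^ j₂ ≤ (P.L : ℝ) ^ j₁ * P.L := by rw [← pow_succ]; exact pow_le_pow_right₀ hL1 hcol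
    exact pow_le_pow_left₀ (by positivity) (by nlinarith [hη.le]) 3
  calc ∑ b : PBond P 0, (w₃ b)⁻¹ * ks b.tgt i
      ≤ ∑ b : PBond P 0, (P.L : ℝ) ^ 3 * ((w₃ (e b))⁻¹ * ks (e b).src i) := by
        refine Finset.sum_le_sum fun b _ => ?_
        rw [he, ← mul_assoc]
        exact mul_le_mul_of_nonneg_right (hcollar b) (hks0 _ _)
    _ = (P.L : ℝ) ^ 3 * ∑ b : PBond P 0, (w₃ (e b))⁻¹ * ks (e b).src i := by rw [Finset.mul_sum]
    _ = (P.L : ℝ) ^ 3 * ∑ b : PBond P 0, (w₃ b)⁻¹ * ks b.src i := by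
        rw [Equiv.sum_comp e (fun b : PBond P 0 => (w₃ b)⁻¹ * ks b.src i)]
    _ ≤ (P.L : ℝ) ^ 3 * (K₀ * (η⁻¹) ^ 3) := mul_le_mul_of_nonneg_left (hcol i) (by positivity)

include hXf hκ0 hκs hXt hY hw₃ hK hcol in
/-- **THE COLUMN LETTER OF `Y = H₀ᴹX̃′`**: `Σ_b (L^{j(b)}η)⁻³‖Y(b)‖ ≤ K₀η⁻³(1 + 2d(d+2)L)·Σ_{(j,c)} (Lʲη)⁻¹‖X(j,c)‖` — the column sums of `H₀`
against the `ℓ¹` size of the corrected data. [cite: Balaban1985Variational, (46) p.285, (156)-(157) p.302; Balaban1984PropagatorsII, (2.61) p.234] -/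
theorem column_letter_Y (hη : 0 < η) (hK₀ : 0 ≤ K₀) (X : BondIdx D → Matrix n n ℂ) :
    ∑ b : PBond P 0, (w₃ b)⁻¹ * ‖Y X b‖ ≤ K₀ * (η⁻¹) ^ 3 * ((1 + 2 * (((P.d + 2) * P.L : ℕ) : ℝ) * P.d) *
      ∑ i : BondIdx D, ((P.L : ℝ) ^ (i.1.1 : ℕ) * η)⁻¹ * ‖X i‖) := by
  classical
  have hL0 : (0 : ℝ) < P.L := by exact_mod_cast P.L_pos
  have hw0 : ∀ b, 0 ≤ (w₃ b)⁻¹ := fun b => by rw [hw₃]; positivity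
  have h1 : ∀ b, ‖Y X b‖ ≤ ∑ i, |H₀ (Pi.single i 1) b| * ‖Xt X i‖ := fun b => by
    rw [hY]; refine (norm_sum_le _ _).trans (Finset.sum_le_sum fun i _ => ?_); rw [norm_smul, Real.norm_eq_abs]
  calc ∑ b, (w₃ b)⁻¹ * ‖Y X b‖ ≤ ∑ b, (w₃ b)⁻¹ * ∑ i, |H₀ (Pi.single i 1) b| * ‖Xt X i‖ :=
        Finset.sum_le_sum fun b _ => mul_le_mul_of_nonneg_left (h1 b) (hw0 b)
    _ = ∑ i, (∑ b, (w₃ b)⁻¹ * |H₀ (Pi.single i 1) b|) * ‖Xt X i‖ := by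
        simp_rw [Finset.mul_sum, Finset.sum_mul]
        rw [Finset.sum_comm]
        exact Finset.sum_congr rfl fun i _ => Finset.sum_congr rfl fun b _ => by ring
    _ ≤ ∑ i, (K₀ * (η⁻¹) ^ 3) * ‖Xt X i‖ :=
        Finset.sum_le_sum fun i _ => mul_le_mul_of_nonneg_right (colsum_kernel_le D η H₀ w₃ hw₃ ks hK hcol hη i) (norm_nonneg _)
    _ = K₀ * (η⁻¹) ^ 3 * ∑ i, ‖Xt X i‖ := by rw [Finset.mul_sum]
    _ ≤ _ := mul_le_mul_of_nonneg_left (sum_norm_Xt_le D η Xf hXf κ hκ0 hκs Xt hXt hη X) (by positivity)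

include hΛ0 hΛs hXf hκ0 hκs hXt hY hτ0 hφ hw₃ hτlip hks0 hK hblk hcol in
/-- **THE COLUMN LETTER OF THE GAUGE PART `dφ`**: only the tents of the blocks containing an end-point of `b` move across `b` (slope `θ/Lʲ`), `‖Λ_s(Y)‖ ≤
(d+2)L·L^{j(s)}·sup_{B(s)}‖Y‖ with the block value of the kernel majorant (the `L^{j(s)}` cancel), the sums over the site indices collapse to the pins of the two
end-points, and the final points cost the collar factor `L³`: `Σ_b (L^{j(b)}η)⁻³‖φ(b₊) − φ(b₋)‖ ≤ θ(d+2)L(1+L³)·K₀η⁻³·(1 + 2d(d+2)L)·Σ_{(j,c)} (Lʲη)⁻¹‖X(j,c)‖`.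
[cite: Balaban1985Variational, (46) p.285, (161) p.303; Balaban1985Averaging, (62) p.28; Balaban1984PropagatorsII, (2.2)-(2.4) p.224, (2.61) p.234] -/
theorem column_letter_dphi (hη : 0 < η) (hθ : 0 ≤ θ) (hK₀ : 0 ≤ K₀) {R M : ℕ} (hAdm : Adm22 D R M) (hRM : 1 ≤ R * M)
    (X : BondIdx D → Matrix n n ℂ) :
    ∑ b : PBond P 0, (w₃ b)⁻¹ * ‖φ X b.tgt - φ X b.src‖ ≤
      θ * ((P.d + 2) * P.L : ℕ) * (1 + (P.L : ℝ) ^ 3) * (K₀ * (η⁻¹) ^ 3) *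
        ((1 + 2 * (((P.d + 2) * P.L : ℕ) : ℝ) * P.d) * ∑ i : BondIdx D, ((P.L : ℝ) ^ (i.1.1 : ℕ) * η)⁻¹ * ‖X i‖) := by
  classical
  have hL0 : (0 : ℝ) < P.L := by exact_mod_cast P.L_pos
  have hw0 : ∀ b, 0 ≤ (w₃ b)⁻¹ := fun b => by rw [hw₃]; positivity
  set C : ℝ := (((P.d + 2) * P.L : ℕ) : ℝ) with hC
  have hC0 : 0 ≤ C := by positivity
  -- the pin of a fine site and the centre of a site index
  let pin : Site P 0 → SiteIdx D := fun x =>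
    ⟨⟨⟨levOf (fun i => {z : Site P 0 | D.InOm i z}) D.k x, pin_mem D x⟩,
      iterBlockOf (levOf (fun i => {z : Site P 0 | D.InOm i z}) D.k x) x⟩, FlatCubeLevels.lamSite_levOf_inOm D x⟩
  have hpin : ∀ x, iterBlockOf ((pin x).1.1 : ℕ) x = (pin x).1.2 := fun x => rfl
  let cs : SiteIdx D → Site P 0 := fun s => embIter (s.1.1 : ℕ) s.1.2
  have hcs : ∀ s : SiteIdx D, iterBlockOf (s.1.1 : ℕ) (cs s) = s.1.2 := fun s =>
    iterBlockOf_embIter (s.1.1 : ℕ) ((D.le_of_lamSite s.2).trans D.hk) s.1.2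
  -- the block bound for `Y` on `B(s)` through the block value of the majorant at the centre
  set A : SiteIdx D → ℝ := fun s => ∑ i, ks (cs s) i * ‖Xt X i‖ with hA
  have hA0 : ∀ s, 0 ≤ A s := fun s => Finset.sum_nonneg fun i _ => mul_nonneg (hks0 _ i) (norm_nonneg _)
  have hApin : ∀ x : Site P 0, A (pin x) = ∑ i, ks x i * ‖Xt X i‖ := fun x =>
    Finset.sum_congr rfl fun i _ => by rw [hblk i (pin x) (cs (pin x)) x (hcs (pin x)) (hpin x)]
  have hYblk : ∀ (s : SiteIdx D) (b' : PBond P 0), iterBlockOf (s.1.1 : ℕ) b'.src = s.1.2 → ‖Y X b'‖ ≤ A s := fun s b' hb' => by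
    rw [hY]; refine (norm_sum_le _ _).trans (Finset.sum_le_sum fun i _ => ?_)
    rw [norm_smul, Real.norm_eq_abs, hblk i s (cs s) b'.src (hcs s) hb']; exact mul_le_mul_of_nonneg_right (hK i b') (norm_nonneg _)
  have hΛb : ∀ s : SiteIdx D, ‖Λ (s.1.1 : ℕ) (Y X) s.1.2‖ ≤ C * (P.L : ℝ) ^ (s.1.1 : ℕ) * A s := fun s =>
    norm_combFamily_le Λ hΛ0 hΛs ((D.le_of_lamSite s.2).trans D.hk) (Y X) s.1.2 (hA0 s) (fun b' hbs _ => hYblk s b' hbs)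
  -- the pointwise bound of one tent term
  have hpt : ∀ (s : SiteIdx D) (b : PBond P 0),
      (w₃ b)⁻¹ * (|τ s b.tgt - τ s b.src| * ‖Λ (s.1.1 : ℕ) (Y X) s.1.2‖) ≤
        θ * C * (((if iterBlockOf (s.1.1 : ℕ) b.src = s.1.2 then (w₃ b)⁻¹ * A s else 0)) +
          (if iterBlockOf (s.1.1 : ℕ) b.tgt = s.1.2 then (w₃ b)⁻¹ * A s else 0)) := by
    intro s b
    have hLj : (0 : ℝ) < (P.L : ℝ) ^ (s.1.1 : ℕ) := by positivity
    have ht0 : 0 ≤ (if iterBlockOf (s.1.1 : ℕ) b.tgt = s.1.2 then (w₃ b)⁻¹ * A s else 0) := by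
      split_ifs; exacts [mul_nonneg (hw0 b) (hA0 s), le_rfl]
    -- the moving tent: slope `θ/Lʲ` against `‖Λ_s‖ ≤ C·Lʲ·A(s)`
    have hmove : (w₃ b)⁻¹ * (|τ s b.tgt - τ s b.src| * ‖Λ (s.1.1 : ℕ) (Y X) s.1.2‖) ≤ θ * C * ((w₃ b)⁻¹ * A s) := by
      calc (w₃ b)⁻¹ * (|τ s b.tgt - τ s b.src| * ‖Λ (s.1.1 : ℕ) (Y X) s.1.2‖)
          ≤ (w₃ b)⁻¹ * ((θ / (P.L : ℝ) ^ (s.1.1 : ℕ)) * (C * (P.L : ℝ) ^ (s.1.1 : ℕ) * A s)) :=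
            mul_le_mul_of_nonneg_left (mul_le_mul (hτlip s b) (hΛb s) (norm_nonneg _) (by positivity)) (hw0 b)
        _ = θ * C * ((w₃ b)⁻¹ * A s) := by field_simp
    by_cases hs : iterBlockOf (s.1.1 : ℕ) b.src = s.1.2
    · rw [if_pos hs]; exact hmove.trans (mul_le_mul_of_nonneg_left (le_add_of_nonneg_right ht0) (by positivity))
    · by_cases ht : iterBlockOf (s.1.1 : ℕ) b.tgt = s.1.2
      · rw [if_neg hs, if_pos ht, zero_add]; exact hmove
      · rw [hτ0 s b.tgt ht, hτ0 s b.src hs, sub_zero, abs_zero, zero_mul, mul_zero, if_neg hs, if_neg ht, add_zero, mul_zero]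
  -- the differences of `φ`
  have hdiff : ∀ b : PBond P 0, φ X b.tgt - φ X b.src = ∑ s : SiteIdx D, (τ s b.tgt - τ s b.src) • Λ (s.1.1 : ℕ) (Y X) s.1.2 := fun b => by
    rw [hφ, hφ, ← Finset.sum_sub_distrib]; exact Finset.sum_congr rfl fun s _ => by rw [sub_smul]
  have h1 : ∀ b : PBond P 0, ‖φ X b.tgt - φ X b.src‖ ≤ ∑ s : SiteIdx D, |τ s b.tgt - τ s b.src| * ‖Λ (s.1.1 : ℕ) (Y X) s.1.2‖ := fun b => by
    rw [hdiff]; refine (norm_sum_le _ _).trans (Finset.sum_le_sum fun s _ => ?_); rw [norm_smul, Real.norm_eq_abs]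
  -- the two collapsed sums
  have hsrc : ∀ b : PBond P 0, ∑ s : SiteIdx D, (if iterBlockOf (s.1.1 : ℕ) b.src = s.1.2 then (w₃ b)⁻¹ * A s else 0) =
      (w₃ b)⁻¹ * ∑ i, ks b.src i * ‖Xt X i‖ := fun b => by
    rw [sum_siteIdx_ite_block D b.src (fun s => (w₃ b)⁻¹ * A s)]
    show (w₃ b)⁻¹ * A (pin b.src) = _
    rw [hApin]
  have htgt : ∀ b : PBond P 0, ∑ s : SiteIdx D, (if iterBlockOf (s.1.1 : ℕ) b.tgt = s.1.2 then (w₃ b)⁻¹ * A s else 0) =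
      (w₃ b)⁻¹ * ∑ i, ks b.tgt i * ‖Xt X i‖ := fun b => by
    rw [sum_siteIdx_ite_block D b.tgt (fun s => (w₃ b)⁻¹ * A s)]
    show (w₃ b)⁻¹ * A (pin b.tgt) = _
    rw [hApin]
  have hS : ∑ b : PBond P 0, (w₃ b)⁻¹ * ∑ i, ks b.src i * ‖Xt X i‖ ≤ K₀ * (η⁻¹) ^ 3 * ∑ i, ‖Xt X i‖ := by
    calc ∑ b : PBond P 0, (w₃ b)⁻¹ * ∑ i, ks b.src i * ‖Xt X i‖ = ∑ i, (∑ b : PBond P 0, (w₃ b)⁻¹ * ks b.src i) * ‖Xt X i‖ := by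
          simp_rw [Finset.mul_sum, Finset.sum_mul]
          rw [Finset.sum_comm]
          exact Finset.sum_congr rfl fun i _ => Finset.sum_congr rfl fun b _ => by ring
      _ ≤ ∑ i, (K₀ * (η⁻¹) ^ 3) * ‖Xt X i‖ := Finset.sum_le_sum fun i _ => mul_le_mul_of_nonneg_right (hcol i) (norm_nonneg _)
      _ = K₀ * (η⁻¹) ^ 3 * ∑ i, ‖Xt X i‖ := by rw [Finset.mul_sum]
  have hT : ∑ b : PBond P 0, (w₃ b)⁻¹ * ∑ i, ks b.tgt i * ‖Xt X i‖ ≤ (P.L : ℝ) ^ 3 * (K₀ * (η⁻¹) ^ 3) * ∑ i, ‖Xt X i‖ := by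
    calc ∑ b : PBond P 0, (w₃ b)⁻¹ * ∑ i, ks b.tgt i * ‖Xt X i‖ = ∑ i, (∑ b : PBond P 0, (w₃ b)⁻¹ * ks b.tgt i) * ‖Xt X i‖ := by
          simp_rw [Finset.mul_sum, Finset.sum_mul]
          rw [Finset.sum_comm]
          exact Finset.sum_congr rfl fun i _ => Finset.sum_congr rfl fun b _ => by ring
      _ ≤ ∑ i, ((P.L : ℝ) ^ 3 * (K₀ * (η⁻¹) ^ 3)) * ‖Xt X i‖ :=
          Finset.sum_le_sum fun i _ => mul_le_mul_of_nonneg_right (colsum_tgt_le D η w₃ hw₃ ks hks0 hcol hη hAdm hRM i) (norm_nonneg _)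
      _ = (P.L : ℝ) ^ 3 * (K₀ * (η⁻¹) ^ 3) * ∑ i, ‖Xt X i‖ := by rw [Finset.mul_sum]
  -- the main chain
  calc ∑ b, (w₃ b)⁻¹ * ‖φ X b.tgt - φ X b.src‖
      ≤ ∑ b, (w₃ b)⁻¹ * ∑ s : SiteIdx D, |τ s b.tgt - τ s b.src| * ‖Λ (s.1.1 : ℕ) (Y X) s.1.2‖ :=
        Finset.sum_le_sum fun b _ => mul_le_mul_of_nonneg_left (h1 b) (hw0 b)
    _ = ∑ b, ∑ s : SiteIdx D, (w₃ b)⁻¹ * (|τ s b.tgt - τ s b.src| * ‖Λ (s.1.1 : ℕ) (Y X) s.1.2‖) := by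
        simp_rw [Finset.mul_sum]
    _ ≤ ∑ b, ∑ s : SiteIdx D, θ * C * (((if iterBlockOf (s.1.1 : ℕ) b.src = s.1.2 then (w₃ b)⁻¹ * A s else 0)) +
          (if iterBlockOf (s.1.1 : ℕ) b.tgt = s.1.2 then (w₃ b)⁻¹ * A s else 0)) :=
        Finset.sum_le_sum fun b _ => Finset.sum_le_sum fun s _ => hpt s b
    _ = θ * C * ∑ b, ((w₃ b)⁻¹ * ∑ i, ks b.src i * ‖Xt X i‖ + (w₃ b)⁻¹ * ∑ i, ks b.tgt i * ‖Xt X i‖) := by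
        rw [Finset.mul_sum]
        refine Finset.sum_congr rfl fun b _ => ?_
        rw [← Finset.mul_sum, Finset.sum_add_distrib, hsrc b, htgt b]
    _ = θ * C * (∑ b, (w₃ b)⁻¹ * ∑ i, ks b.src i * ‖Xt X i‖ + ∑ b, (w₃ b)⁻¹ * ∑ i, ks b.tgt i * ‖Xt X i‖) := by
        rw [Finset.sum_add_distrib]
    _ ≤ θ * C * (K₀ * (η⁻¹) ^ 3 * ∑ i, ‖Xt X i‖ + (P.L : ℝ) ^ 3 * (K₀ * (η⁻¹) ^ 3) * ∑ i, ‖Xt X i‖) :=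
        mul_le_mul_of_nonneg_left (add_le_add hS hT) (by positivity)
    _ = θ * C * (1 + (P.L : ℝ) ^ 3) * (K₀ * (η⁻¹) ^ 3) * ∑ i, ‖Xt X i‖ := by ring
    _ ≤ θ * C * (1 + (P.L : ℝ) ^ 3) * (K₀ * (η⁻¹) ^ 3) *
          ((1 + 2 * (((P.d + 2) * P.L : ℕ) : ℝ) * P.d) * ∑ i : BondIdx D, ((P.L : ℝ) ^ (i.1.1 : ℕ) * η)⁻¹ * ‖X i‖) :=
        mul_le_mul_of_nonneg_left (sum_norm_Xt_le D η Xf hXf κ hκ0 hκs Xt hXt hη X) (by positivity)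

include hΛ0 hΛs hXf hκ0 hκs hXt hY hτ0 hφ hw₃ hτlip hks0 hK hblk hcol in
/-- **THE COLUMN LETTER OF `H X = Y X + dφ X`** (the `ℓ¹`-DUAL of the transposed weighted sup letter; shared index weight `u(j,c) = η⁻³(Lʲη)⁻¹`, fine weight
`v(b) = (L^{j(b)}η)⁻³`): for EVERY datum `X`, `Σ_b (L^{j(b)}η)⁻³‖HX(b)‖ ≤ h₁·Σ_{(j,c)} η⁻³(Lʲη)⁻¹‖X(j,c)‖` with `h₁ = K₀(1 + θ(d+2)L(1+L³))(1 + 2d(d+2)L)`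
— from a block-constant kernel majorant `k(y(b₋), i)` of `H₀` with column sum `Σ_b (L^{j(b)}η)⁻³k(b₋, i) ≤ K₀η⁻³`, the tents' support and slope `θ/Lʲ`, under
(2.2)-admissibility with `R·M ≥ 1`. [cite: Balaban1985Variational, (46) p.285, (88)-(90) pp.291-292, (161)-(162) p.303; Balaban1984PropagatorsII, (2.61) p.234, Cor. 2.8 (2.150)-(2.151) p.249] -/
theorem column_letter (hη : 0 < η) (hθ : 0 ≤ θ) (hK₀ : 0 ≤ K₀) {R M : ℕ} (hAdm : Adm22 D R M) (hRM : 1 ≤ R * M)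
    (Hf : (BondIdx D → Matrix n n ℂ) → PBond P 0 → Matrix n n ℂ) (hHf : ∀ X b, Hf X b = Y X b + (φ X b.tgt - φ X b.src))
    (X : BondIdx D → Matrix n n ℂ) :
    ∑ b : PBond P 0, (w₃ b)⁻¹ * ‖Hf X b‖ ≤
      (K₀ * (1 + θ * ((P.d + 2) * P.L : ℕ) * (1 + (P.L : ℝ) ^ 3)) * (1 + 2 * (((P.d + 2) * P.L : ℕ) : ℝ) * P.d)) *
        ∑ i : BondIdx D, ((η⁻¹) ^ 3 * ((P.L : ℝ) ^ (i.1.1 : ℕ) * η)⁻¹) * ‖X i‖ := by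
  classical
  have hL0 : (0 : ℝ) < P.L := by exact_mod_cast P.L_pos
  have hw0 : ∀ b, 0 ≤ (w₃ b)⁻¹ := fun b => by rw [hw₃]; positivity
  have hYb := column_letter_Y D η Xf hXf κ hκ0 hκs Xt hXt H₀ Y hY w₃ hw₃ ks hK hcol hη hK₀ X
  have hφb := column_letter_dphi D η Λ hΛ0 hΛs Xf hXf κ hκ0 hκs Xt hXt H₀ Y hY τ hτ0 φ hφ w₃ hw₃ hτlip ks hks0 hK hblk hcol hη hθ hK₀ hAdm hRM X
  have hsplit : ∀ b, (w₃ b)⁻¹ * ‖Hf X b‖ ≤ (w₃ b)⁻¹ * ‖Y X b‖ + (w₃ b)⁻¹ * ‖φ X b.tgt - φ X b.src‖ := fun b => by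
    rw [hHf, ← mul_add]; exact mul_le_mul_of_nonneg_left (norm_add_le _ _) (hw0 b)
  have hu : ∑ i : BondIdx D, ((η⁻¹) ^ 3 * ((P.L : ℝ) ^ (i.1.1 : ℕ) * η)⁻¹) * ‖X i‖ =
      (η⁻¹) ^ 3 * ∑ i : BondIdx D, ((P.L : ℝ) ^ (i.1.1 : ℕ) * η)⁻¹ * ‖X i‖ := by
    rw [Finset.mul_sum]; exact Finset.sum_congr rfl fun i _ => by ring
  calc ∑ b, (w₃ b)⁻¹ * ‖Hf X b‖ ≤ ∑ b, ((w₃ b)⁻¹ * ‖Y X b‖ + (w₃ b)⁻¹ * ‖φ X b.tgt - φ X b.src‖) := Finset.sum_le_sum fun b _ => hsplit b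
    _ = ∑ b, (w₃ b)⁻¹ * ‖Y X b‖ + ∑ b, (w₃ b)⁻¹ * ‖φ X b.tgt - φ X b.src‖ := Finset.sum_add_distrib
    _ ≤ _ := add_le_add hYb hφb
    _ = _ := by rw [hu]; ring

end ColumnLetter

end ConstructionB

/-! ## §4 Packaging: the right inverse of `exists_rightInverse` WITH the column letter -/

section PackageCol

variable [Fintype n] [DecidableEq n]

/-- **THE BRIDGE WITH THE COLUMN LETTER**: as `ChartHInvLetter.exists_rightInverse` (a ℂ-linear right inverse `H` of the true linearisation `η·Q^{(j)}` on the
index bonds from ANY real right inverse `H₀` of the straight averages, with the weighted sup letter (46)), for `H₀` carrying ALSO a kernel majorant `k(x, i)` of its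
`i`-columns (`|H₀(b, i)| ≤ k(b₋, i)`), CONSTANT on the block of every site index and with the column sum `Σ_b (L^{j(b)}η)⁻³k(b₋, i) ≤ K₀η⁻³` ([Balaban1984PropagatorsII]
Cor. 2.8 (2.151)₁ + the plain scale sum (2.61), the concrete half): the SAME `H` obeys `Σ_b (L^{j(b)}η)⁻³‖HX(b)‖ ≤ h₁·Σ_{(j,c)} η⁻³(Lʲη)⁻¹‖X(j,c)‖`,
`h₁ = K₀(1 + 2(d+2)L(1+L³))(1 + 2d(d+2)L)` — the `ℓ¹`-dual form of «`Hᵀ` maps `(Lʲη)³`-weighted currents to `η³(Lʲη)`-weighted index functions» consumed by the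
(88)–(90) dressing estimates. [cite: Balaban1985Variational, (45)-(46) p.285, (88)-(90) pp.291-292, (156)-(157) p.302, (161)-(162) p.303; Balaban1984PropagatorsII, (2.61) p.234, Cor. 2.8 (2.150)-(2.151) p.249] -/
theorem exists_rightInverse_col (D : Domains P) {R M : ℕ} (hAdm : Adm22 D R M) (hRM : 2 * P.L ≤ R * M + 1) {η : ℝ} (hη : 0 < η)
    (w₁ : PBond P 0 → ℝ) (hw₁ : ∀ b, w₁ b = (P.L : ℝ) ^ levOf (fun i => {z : Site P 0 | D.InOm i z}) D.k b.src * η)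
    (w₃ : PBond P 0 → ℝ) (hw₃ : ∀ b, w₃ b = ((P.L : ℝ) ^ levOf (fun i => {z : Site P 0 | D.InOm i z}) D.k b.src * η) ^ 3)
    (H₀ : (BondIdx D → ℝ) →ₗ[ℝ] (PBond P 0 → ℝ)) (hinv : ∀ (X : BondIdx D → ℝ) (i : BondIdx D), bondAvgIter (i.1.1 : ℕ) (H₀ X) i.1.2 = X i)
    {B₀ : ℝ} (hB₀ : 0 ≤ B₀)
    (hsup : ∀ (Xr : BondIdx D → ℝ) (t : ℝ), 0 ≤ t → (∀ i, ((P.L : ℝ) ^ (i.1.1 : ℕ) * η) * |Xr i| ≤ t) → ∀ b, w₁ b * |H₀ Xr b| ≤ B₀ * t)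
    (ks : Site P 0 → BondIdx D → ℝ) (hks0 : ∀ x i, 0 ≤ ks x i)
    (hK : ∀ (i : BondIdx D) (b : PBond P 0), |H₀ (Pi.single i 1) b| ≤ ks b.src i)
    (hblk : ∀ (i : BondIdx D) (s : SiteIdx D) (x x' : Site P 0), iterBlockOf (s.1.1 : ℕ) x = s.1.2 → iterBlockOf (s.1.1 : ℕ) x' = s.1.2 →
      ks x i = ks x' i)
    {K₀ : ℝ} (hK₀ : 0 ≤ K₀) (hcol : ∀ i, ∑ b : PBond P 0, (w₃ b)⁻¹ * ks b.src i ≤ K₀ * (η⁻¹) ^ 3)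
    (Q : (i : ℕ) → (PBond P 0 → Matrix n n ℂ) → PBond P i → Matrix n n ℂ)
    (hQ0 : ∀ Y, Q 0 Y = Y) (hQs : ∀ (i : ℕ) (Y : PBond P 0 → Matrix n n ℂ) (c : PBond P (i + 1)), Q (i + 1) Y c = linAvg (Q i Y) c) :
    ∃ H : (BondIdx D → Matrix n n ℂ) →ₗ[ℂ] (PBond P 0 → Matrix n n ℂ),
      (∀ (X : BondIdx D → Matrix n n ℂ) (idx : BondIdx D), (η : ℂ) • Q (idx.1.1 : ℕ) (H X) idx.1.2 = X idx) ∧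
      (∀ (X : BondIdx D → Matrix n n ℂ) (t : ℝ), 0 ≤ t → (∀ i, ‖X i‖ ≤ t) → ∀ b : PBond P 0,
        w₁ b * ‖H X b‖ ≤ B₀ * ((1 + 2 * ((P.d + 2) * P.L : ℕ)) * (1 + 2 * ((P.d + 2) * P.L : ℕ) + 2 * ((P.d + 2) * P.L : ℕ) * P.L)) * t) ∧
      ∀ X : BondIdx D → Matrix n n ℂ, ∑ b : PBond P 0, (w₃ b)⁻¹ * ‖H X b‖ ≤
        (K₀ * (1 + 2 * ((P.d + 2) * P.L : ℕ) * (1 + (P.L : ℝ) ^ 3)) * (1 + 2 * (((P.d + 2) * P.L : ℕ) : ℝ) * P.d)) *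
          ∑ i : BondIdx D, ((η⁻¹) ^ 3 * ((P.L : ℝ) ^ (i.1.1 : ℕ) * η)⁻¹) * ‖X i‖ := by
  classical
  obtain ⟨Λ, hΛ0, hΛs⟩ := exists_combFamily (P := P) (n := n)
  have htent := fun s : SiteIdx D => exists_tent (P := P) (j := (s.1.1 : ℕ)) ((D.le_of_lamSite s.2).trans D.hk) s.1.2
  choose τ hτ1 hτ0 _hτ01 hτlip using htent
  obtain ⟨Xf, hXf⟩ : ∃ Xf : (BondIdx D → Matrix n n ℂ) → (i : ℕ) → PBond P i → Matrix n n ℂ,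
      ∀ X i b, Xf X i b = if h : D.LamBond i b then X ⟨⟨⟨i, Nat.lt_succ_of_le (D.le_of_lamBond h)⟩, b⟩, h⟩ else 0 := ⟨_, fun _ _ _ => rfl⟩
  obtain ⟨κ, hκ0, hκs⟩ : ∃ κ : (BondIdx D → Matrix n n ℂ) → (j : ℕ) → Site P j → Matrix n n ℂ,
      (∀ X y, κ X 0 y = 0) ∧ ∀ X (i : ℕ) (y : Site P (i + 1)), κ X (i + 1) y = if y ∈ D.Om (i + 1) then 0 else combMean (Xf X i) y :=
    ⟨fun X j => Nat.rec (motive := fun j => Site P j → Matrix n n ℂ) (fun _ => 0)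
      (fun i _ y => if y ∈ D.Om (i + 1) then 0 else combMean (Xf X i) y) j, fun _ _ => rfl, fun _ _ _ => rfl⟩
  obtain ⟨Xt, hXt⟩ : ∃ Xt : (BondIdx D → Matrix n n ℂ) → BondIdx D → Matrix n n ℂ,
      ∀ X idx, Xt X idx = (((P.L : ℝ) ^ (idx.1.1 : ℕ) * η)⁻¹) • (X idx + (κ X idx.1.1 idx.1.2.tgt - κ X idx.1.1 idx.1.2.src)) :=
    ⟨_, fun _ _ => rfl⟩
  obtain ⟨Y, hY⟩ : ∃ Y : (BondIdx D → Matrix n n ℂ) → PBond P 0 → Matrix n n ℂ, ∀ X b, Y X b = ∑ i : BondIdx D, H₀ (Pi.single i 1) b • Xt X i :=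
    ⟨_, fun _ _ => rfl⟩
  obtain ⟨φ, hφ⟩ : ∃ φ : (BondIdx D → Matrix n n ℂ) → Site P 0 → Matrix n n ℂ, ∀ X x, φ X x = ∑ s : SiteIdx D, τ s x • Λ (s.1.1 : ℕ) (Y X) s.1.2 :=
    ⟨_, fun _ _ => rfl⟩
  obtain ⟨Hf, hHf⟩ : ∃ Hf : (BondIdx D → Matrix n n ℂ) → PBond P 0 → Matrix n n ℂ, ∀ X b, Hf X b = Y X b + (φ X b.tgt - φ X b.src) :=
    ⟨_, fun _ _ => rfl⟩
  -- linearity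
  have hadd : ∀ X X', Hf (X + X') = Hf X + Hf X' := fun X X' => funext fun b => by
    rw [Pi.add_apply, hHf, hHf, hHf, Y_add D η Xf hXf κ hκ0 hκs Xt hXt H₀ Y hY,
      phi_add D η Λ hΛ0 hΛs Xf hXf κ hκ0 hκs Xt hXt H₀ Y hY τ φ hφ, phi_add D η Λ hΛ0 hΛs Xf hXf κ hκ0 hκs Xt hXt H₀ Y hY τ φ hφ]
    abel
  have hsmul : ∀ (a : ℂ) X, Hf (a • X) = a • Hf X := fun a X => funext fun b => by
    rw [Pi.smul_apply, hHf, hHf, Y_smul D η Xf hXf κ hκ0 hκs Xt hXt H₀ Y hY,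
      phi_smul D η Λ hΛ0 hΛs Xf hXf κ hκ0 hκs Xt hXt H₀ Y hY τ φ hφ, phi_smul D η Λ hΛ0 hΛs Xf hXf κ hκ0 hκs Xt hXt H₀ Y hY τ φ hφ,
      smul_add, smul_sub]
  let H : (BondIdx D → Matrix n n ℂ) →ₗ[ℂ] (PBond P 0 → Matrix n n ℂ) :=
    { toFun := Hf, map_add' := hadd, map_smul' := hsmul }
  have hRM1 : 1 ≤ R * M := by have := P.hL.2; omega
  refine ⟨H, fun X idx => ?_, fun X t ht hX b => ?_, fun X => ?_⟩
  · show (η : ℂ) • Q (idx.1.1 : ℕ) (Hf X) idx.1.2 = X idx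
    rw [show Hf X = fun b => Y X b + (φ X b.tgt - φ X b.src) from funext (hHf X)]
    exact main_identity D η Q hQ0 hQs Λ hΛ0 hΛs Xf hXf κ hκ0 hκs Xt hXt H₀ hinv Y hY τ hτ1 hτ0 φ hφ hAdm hRM hη.ne' X idx
  · show w₁ b * ‖Hf X b‖ ≤ _
    exact letter D η Λ hΛ0 hΛs Xf hXf κ hκ0 hκs Xt hXt H₀ Y hY τ hτ0 φ hφ w₁ hw₁ hsup hτlip hAdm hRM1 hη hB₀ Hf hHf X ht hX b
  · show ∑ b : PBond P 0, (w₃ b)⁻¹ * ‖Hf X b‖ ≤ _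
    exact column_letter D η Λ hΛ0 hΛs Xf hXf κ hκ0 hκs Xt hXt H₀ Y hY τ hτ0 φ hφ w₃ hw₃ hτlip ks hks0 hK hblk hcol hη
      (by norm_num) hK₀ hAdm hRM1 Hf hHf X

end PackageCol

end Summit.QuantumFields.YangMills.Theorems.ChartHInv

end
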